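import Summits.QuantumFields.YangMills.Theorems.BalabanUVNodesN18KernelLettersFirstEntryOnly

/-!
# BalabanUVNodes ∕ N18 — THE U3 → U2 EDGE IN RUN-WINDOW CURRENCY (R-N18-RUN, constructive half): N18's η-rate read ONLY ALONG THE SLIDING WINDOWS OF IN-WINDOW (0.20)-RUNS
# + the (D4) read-out ⟹ dag-n17-w1's RUN-WINDOW N17 TEXT (`…N17RunWindowShift` p607164 §1's hypothesis `hW`, VERBATIM) — the box-wide quantifier of `SpineRates.n17At_of_u3` is
# NOT needed by the K2∕K1 roads, and under the F-E shadow (FILE 1) it is the part that dies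
# (Track A, DAG node N18 = NE5 → N17 in-edge; key K3⁸ `SpineGivenEndpointR13SepCoPHV` = stmt-QuantumFields-27366, skeleton v6 b4e55110ab73e679; width seat `pub-ymgap-dag-n18-w1` g6,
# FILE 3 — successor of FILE 1 `…N18KernelLettersFirstEntryOnly` §3 (the run-keyed survivor) and of dag-n17-w1 g4's F5 answer (δ))

HONEST FRAMING.  Count-neutral kernel bookkeeping BY NAME (`--kind proof --supports stmt-QuantumFields-27366 --as helper`).  This file is pv∕t4's liaison lemma
`T4BetaReadOutLipschitz.scaleShiftRate_of_ne5_on` READ POINTWISE: its proof uses NE5 only at the ONE re-indexed sequence `extd (Fin.tail w)` of each box history `w`, so the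
U3 → U2 edge holds history-by-history, hence on ANY family of histories — in particular on the sliding windows `(g_j, …, g_{j+k+1})` of in-window runs of (0.20), which is
EXACTLY the run-window N17 text dag-n17-w1's K2⁷ road consumes (`exists_runConstRemainder_of_runWindowShift_cornerStep_scaleAnchor`, `runRemAt_of_runWindowShift_scaleAnchor_survContAt`;
not imported here — theses-cone hygiene — the text is reproduced VERBATIM as a conclusion).  NE5 (N18's input, NOT PRINTED for d = 4), the read-out binders (D4) and the runs'
window-stability (`Step.InInterval`) are DISPLAYED HYPOTHESES; nothing of Bałaban's is asserted, inhabited, discharged or refuted; N17 ∕ N18 NOT discharged; K3⁸ OPEN (v6), no stub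
proved ∕ refuted; K3⁷ 20544 aside; NO skeleton is re-keyed by this file (R-N18-RUN is a located input for the definers ∕ plan, FILE 1's evidence memo).  Counts UNMOVED (typed 28∕28 ·
discharged 5∕27, A 5∕28).  One finite four-torus programme at fixed `ε`, Bałaban AS PRINTED; route R4 closes ONLY the conditional finite-𝕋⁴ rung `BalabanLadder.UV` — NOT the continuum
limit, NOT ℝ⁴, NOT OS, NOT the Yang–Mills mass gap, NOT Clay.  THEOREMS ONLY: 0 `def`, 0 `instance`, 0 `sorry`, standard axioms.

WHY.  FILE 1 located that, modulo the ym-nodeO F-E finding, N18's BOX-keyed letter is presumptively uninhabitable at the pinned kernels of record while its RUN-keyed form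
survives (FILE 2: exactly, at the marginal-transport model), and dag-n17-w1's F5 answer located the same for N17 (the K2 road needs only the run-window shift).  The missing
junction is the EDGE between them in run currency: does run-keyed N18 + (D4) still PRODUCE run-window N17?  Yes — the liaison is pointwise (§1), so the run-window N17 text follows
from the RUN-MATCHED NE5 instances at the padded tails of run windows (§1 `runWindowShift_of_ne5AtRunWindows`; first coupling = the run's own `g_j`, no free `b`, no box), i.e. from N18 in kernel SHIFT form along the runs (§2), i.e. — at the record —
from the (D4) binder `ReadOutAt D u` of K3's `PHolderD4` plus the run-matched NE5 instances on `u` (§3).  The BOX enters `SpineRates.ReadOutAt` only through its first clause (`W ⊇` padded boxes),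
which this road does not use.

WHAT (theorems only).  §1 abstract carriers (T4BetaReadOut currency; dag-n17-w1's window facts `tail_prefixOf_shift` ∕ `prefixOf_shift_mem_box` inlined as `have`s, theses-cone hygiene): ★ `shift_le_of_ne5At` (ONE history) · `setShift_of_ne5At` (any family) ·
★★ `runWindowShift_of_ne5AtRunWindows` (dag-n17-w1's run-window text from the RUN-MATCHED NE5 instances only — the F-E-robust keying) · `runWindowShift_of_ne5_onRunWindows` (semi-box
corollary: free first coupling on a `W ⊇` the padded run-window tails; weaker than the box, NOT F-E-robust).  §2 def-W1 kernels (generic `ℰ`): `ne5At_EA_EB_iff_kernel`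
(the NE5 instance at `(b, g)` ⟺ the kernel inequalities at `g`, all levels) · `kernelA_extd_prefixOf_shift` ∕ `kernelA_prepend_extd_prefixOf_shift` (prefix bookkeeping: the padded window
tail and its prepend ARE the shifted run, as far as the kernels read) · ★★ `runWindowShift_of_runWindowKernelStepRate` (N18 IN SHIFT FORM ALONG THE RUNS — `|Π_{k+1}(g_{j+1}, …; z) −
Π_{k+2}(g_j, g_{j+1}, …; z)| ≤ C₅θ^{k+1}e^{−κ|z|₁}` on in-window runs — + (D4) at def-W1's functionals ⟹ the run-window N17 text) · `runWindowKernelStepRate_of_kernelStepRate` (box ⟹ run form).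
§3 K3 currency (`YMDAG.UVSplit`): ★★ `runWindowShift_of_readOutAt_ne5AtRunWindows` (`ReadOutAt D u` + the RUN-MATCHED NE5 instances of `u.EA ∕ u.EB (g_j)` at the padded run-window
tails of `D.βfun`'s in-window runs ⟹ the run-window N17 text for `D.βfun` with `a_k = u.cr·u.C₅·u.θ·u.θ^k`) · `runWindowShift_of_readOutAt_n18At` (the box-keyed `N18At u` is MORE than enough — the run road factors
`SpineRates.n17At_of_u3`'s N17 through the run-window text).

References (TYPES ∕ locators only): [Balaban1987RG1] CMP **109** (1987): (0.18)–(0.20) pp. 255–256, Thm 1 p. 259 (NE5 NOT printed), (1.20)–(1.22) p. 264, §5 p. 298.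
-/

noncomputable section

open scoped BigOperators

namespace YMDAG.N18.RunWindowEdge

open Literature.MathematicalPhysics.QuantumFieldTheory.Balaban1983to89
open Literature.MathematicalPhysics.QuantumFieldTheory.Balaban1983to89.T4Continuum (T4Family)
open Literature.MathematicalPhysics.QuantumFieldTheory.Balaban1983to89.T4OutputRate (Carriers Functional Window NE5)
open Literature.MathematicalPhysics.QuantumFieldTheory.Balaban1983to89.FlowStep (Box HBeta mem_box prefixOf prefixOf_apply RGEqH)
open Literature.MathematicalPhysics.QuantumFieldTheory.Balaban1983to89.T4FlagMemory (extd extd_coe tail_mem_box)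
open Literature.MathematicalPhysics.QuantumFieldTheory.Balaban1983to89.T4FlagMemoryTwoRun (extd_prefixOf)
open Literature.MathematicalPhysics.QuantumFieldTheory.Balaban1983to89.T4BetaReadOut (Slice ReadOut RepresentsA RepresentsB extd_mem_window)
open Literature.MathematicalPhysics.QuantumFieldTheory.Balaban1983to89.T4BetaReadOutLipschitz (ReadCovariantOn)
open Literature.MathematicalPhysics.QuantumFieldTheory.Balaban1983to89.Node00 (TermFamily1 prependCoupling prependCoupling_zero prependCoupling_succ)
open Literature.MathematicalPhysics.QuantumFieldTheory.Balaban1983to89.Node00.U3OfKernels (kernelA EA EB pt carriers histPrefix histPrefix_apply kernelA_congr EA_pt EB_pt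
  prependCoupling_mem_window)
open Literature.MathematicalPhysics.QuantumFieldTheory.Balaban1983to89.Node00.U3KernelLetters (KernelStepRate)
open Literature.MathematicalPhysics.QuantumFieldTheory.Balaban1983to89.B12Sec2to5 (l1)
open YMDAG.UVSplit

/-! ## §1 Abstract carriers: the liaison READ POINTWISE — one history, any family of histories, the sliding windows of in-window runs -/

section Abstract

variable {C : Carriers}

/-- ★ **THE U3 → U2 EDGE AT ONE HISTORY** (pv∕t4's `scaleShiftRate_of_ne5_on`, pointwise): for ONE box history `w ∈ ]0,γ]^{k+2}`, the NE5 INSTANCE at the single re-indexed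
sequence `g := extd (Fin.tail w)` with run B's first coupling `b := w 0`, at the scale-`(k+1)` carrier points only, plus the two read-outs representing `β` and their transport
covariance on classes containing the two slices ⟹ `|β_{k+2}(w) − β_{k+1}(tail w)| ≤ cr·C₅·θ·θ^k`.  No window `W`, no box-wide quantifier. [cite: Balaban1987RG1, (1.20)–(1.22) p.264 and Thm 1 p.259] -/
theorem shift_le_of_ne5At {EA : Functional C C.BgA} {EB : ℝ → Functional C C.BgB} {𝒜A : Set (Slice C C.BgA)} {𝒜B : Set (Slice C C.BgB)}
    {rA : ReadOut C C.BgA} {rB : ReadOut C C.BgB} {β : HBeta} {γ κ θ C₅ cr : ℝ}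
    (hA : RepresentsA EA rA γ β) (hB : RepresentsB EB rB γ β) (hcov : ReadCovariantOn 𝒜A 𝒜B rA rB κ cr)
    {k : ℕ} {w : Fin (k + 2) → ℝ} (hw : w ∈ Box γ (k + 1))
    (hmemA : EA (extd (Fin.tail w)) ∈ 𝒜A) (hmemB : EB (w 0) (extd (Fin.tail w)) ∈ 𝒜B)
    (h5w : ∀ (U : C.BgB) (X : C.Dom), C.scale X = k + 1 →
      |EA (extd (Fin.tail w)) (C.transport U) X - EB (w 0) (extd (Fin.tail w)) U X| ≤ C₅ * θ ^ (k + 1) * Real.exp (-(κ * C.d X))) :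
    |β (k + 1) w - β k (Fin.tail w)| ≤ cr * C₅ * θ * θ ^ k := by
  have hv : Fin.tail w ∈ Box γ k := tail_mem_box hw
  have hr := hcov k _ _ (C₅ * θ ^ (k + 1)) hmemA hmemB h5w
  calc |β (k + 1) w - β k (Fin.tail w)|
      = |rA k (EA (extd (Fin.tail w))) - rB k (EB (w 0) (extd (Fin.tail w)))| := by
        rw [hA k _ hv, hB k w hw, abs_sub_comm]
    _ ≤ cr * (C₅ * θ ^ (k + 1)) := hr
    _ = cr * C₅ * θ * θ ^ k := by ring

/-- **THE EDGE ON ANY FAMILY OF HISTORIES**: NE5 holding on a coupling set `W` (for every `b ∈ ]0,γ]`) gives the shift bound at EVERY box history `w` whose padded tail lies in `W`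
— `W` need NOT contain the padded boxes; it may be exactly the set of padded tails one cares about (run windows, §1's next theorem).
[cite: Balaban1987RG1, (1.20)–(1.22) p.264 and Thm 1 p.259] -/
theorem setShift_of_ne5At {W : Set (ℕ → ℝ)} {EA : Functional C C.BgA} {EB : ℝ → Functional C C.BgB} {𝒜A : Set (Slice C C.BgA)} {𝒜B : Set (Slice C C.BgB)}
    {rA : ReadOut C C.BgA} {rB : ReadOut C C.BgB} {β : HBeta} {γ κ θ C₅ cr : ℝ}
    (h5 : ∀ b, 0 < b → b ≤ γ → NE5 EA (EB b) W κ θ C₅) (hA : RepresentsA EA rA γ β) (hB : RepresentsB EB rB γ β)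
    (h𝒜A : ∀ g ∈ W, EA g ∈ 𝒜A) (h𝒜B : ∀ b, 0 < b → b ≤ γ → ∀ g ∈ W, EB b g ∈ 𝒜B) (hcov : ReadCovariantOn 𝒜A 𝒜B rA rB κ cr)
    {k : ℕ} {w : Fin (k + 2) → ℝ} (hw : w ∈ Box γ (k + 1)) (hg : extd (Fin.tail w) ∈ W) :
    |β (k + 1) w - β k (Fin.tail w)| ≤ cr * C₅ * θ * θ ^ k := by
  have hb : 0 < w 0 ∧ w 0 ≤ γ := (mem_box.mp hw) 0
  refine shift_le_of_ne5At hA hB hcov hw (h𝒜A _ hg) (h𝒜B (w 0) hb.1 hb.2 _ hg) fun U X hX => ?_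
  have h := h5 (w 0) hb.1 hb.2 (extd (Fin.tail w)) hg U X
  rw [hX] at h
  exact h

/-- ★★ **dag-n17-w1's RUN-WINDOW N17 TEXT FROM THE RUN-MATCHED NE5 INSTANCES ONLY (the F-E-robust keying).**  Hypothesis: for every in-window run of (0.20) of `β`
(`RGEqH n β gs ∧ Step.InInterval γ n gs`) and every window `j + (k+1) ≤ n`, the NE5 INSTANCE at the MATCHED pair — run B's first coupling `b := g_j` (the run's OWN coupling one
ultraviolet step up), re-indexed sequence `extd (g_{j+1}, …, g_{j+k+1})` — on the scale-`(k+1)` carrier points, plus the two slice memberships there; with the read-outs representing `β`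
and transport covariance this gives VERBATIM the hypothesis `hW` of `…N17RunWindowShift.exists_runConstRemainder_of_runWindowShift_cornerStep_scaleAnchor` with `a_k := cr·C₅·θ·θ^k`.
NO free first coupling, NO box: under first-entry-only kernels this compares `f_k(g_{j+1})` with `f_{k+1}(g_j)` at RUN-MATCHED entries only (FILE 1 §3 ∕ FILE 2 §4).
[cite: Balaban1987RG1, (0.18)–(0.20) pp.255–256, (1.20)–(1.22) p.264, Thm 1 p.259] -/
theorem runWindowShift_of_ne5AtRunWindows {EA : Functional C C.BgA} {EB : ℝ → Functional C C.BgB} {𝒜A : Set (Slice C C.BgA)}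
    {𝒜B : Set (Slice C C.BgB)} {rA : ReadOut C C.BgA} {rB : ReadOut C C.BgB} {β : HBeta} {γ κ θ C₅ cr : ℝ}
    (hA : RepresentsA EA rA γ β) (hB : RepresentsB EB rB γ β) (hcov : ReadCovariantOn 𝒜A 𝒜B rA rB κ cr)
    (hmemA : ∀ (n : ℕ) (gs : ℕ → ℝ), RGEqH n β gs → Step.InInterval γ n gs → ∀ j k : ℕ, j + (k + 1) ≤ n →
      EA (extd (prefixOf (fun i => gs (j + 1 + i)) k)) ∈ 𝒜A)
    (hmemB : ∀ (n : ℕ) (gs : ℕ → ℝ), RGEqH n β gs → Step.InInterval γ n gs → ∀ j k : ℕ, j + (k + 1) ≤ n →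
      EB (gs j) (extd (prefixOf (fun i => gs (j + 1 + i)) k)) ∈ 𝒜B)
    (h5run : ∀ (n : ℕ) (gs : ℕ → ℝ), RGEqH n β gs → Step.InInterval γ n gs → ∀ j k : ℕ, j + (k + 1) ≤ n →
      ∀ (U : C.BgB) (X : C.Dom), C.scale X = k + 1 →
        |EA (extd (prefixOf (fun i => gs (j + 1 + i)) k)) (C.transport U) X - EB (gs j) (extd (prefixOf (fun i => gs (j + 1 + i)) k)) U X| ≤
          C₅ * θ ^ (k + 1) * Real.exp (-(κ * C.d X))) :
    ∀ (n : ℕ) (gs : ℕ → ℝ), RGEqH n β gs → Step.InInterval γ n gs → ∀ j k : ℕ, j + (k + 1) ≤ n →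
      |β (k + 1) (prefixOf (fun i => gs (j + i)) (k + 1)) - β k (prefixOf (fun i => gs (j + 1 + i)) k)| ≤ cr * C₅ * θ * θ ^ k := by
  intro n gs hR hI j k hjk
  have hw : prefixOf (fun i => gs (j + i)) (k + 1) ∈ Box γ (k + 1) := mem_box.mpr fun i => hI (j + i) (by have := i.isLt; omega)
  have hw0 : prefixOf (fun i => gs (j + i)) (k + 1) 0 = gs j := by simp [prefixOf_apply]
  have htail : Fin.tail (prefixOf (fun i => gs (j + i)) (k + 1)) = prefixOf (fun i => gs (j + 1 + i)) k := by
    funext i; simp only [Fin.tail, prefixOf_apply, Fin.val_succ]; congr 1; omega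
  have h := shift_le_of_ne5At hA hB hcov hw (by rw [htail]; exact hmemA n gs hR hI j k hjk) (by rw [htail, hw0]; exact hmemB n gs hR hI j k hjk)
    (by rw [htail, hw0]; exact h5run n gs hR hI j k hjk)
  rwa [htail] at h

/-- The SEMI-BOX corollary: NE5 with a FREE first coupling `b ∈ ]0,γ]` on a coupling set `W ⊇` the padded run-window tails (+ class memberships on `W`) also gives the run-window text
— weaker than the box letter (`g` restricted to `W`), but NOT the F-E-robust keying: under first-entry-only kernels it still compares independent first entries `(b, g_{j+1})`
(FILE 1 `kernelStepRate_iff_firstEntries_of_firstEntryOnly`).  Recorded for completeness; the run-matched form above is the one R-N18-RUN names.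
[cite: Balaban1987RG1, (0.18)–(0.20) pp.255–256 and Thm 1 p.259] -/
theorem runWindowShift_of_ne5_onRunWindows {W : Set (ℕ → ℝ)} {EA : Functional C C.BgA} {EB : ℝ → Functional C C.BgB} {𝒜A : Set (Slice C C.BgA)}
    {𝒜B : Set (Slice C C.BgB)} {rA : ReadOut C C.BgA} {rB : ReadOut C C.BgB} {β : HBeta} {γ κ θ C₅ cr : ℝ}
    (hWrun : ∀ (n : ℕ) (gs : ℕ → ℝ), RGEqH n β gs → Step.InInterval γ n gs → ∀ j k : ℕ, j + (k + 1) ≤ n →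
      extd (prefixOf (fun i => gs (j + 1 + i)) k) ∈ W)
    (h5 : ∀ b, 0 < b → b ≤ γ → NE5 EA (EB b) W κ θ C₅) (hA : RepresentsA EA rA γ β) (hB : RepresentsB EB rB γ β)
    (h𝒜A : ∀ g ∈ W, EA g ∈ 𝒜A) (h𝒜B : ∀ b, 0 < b → b ≤ γ → ∀ g ∈ W, EB b g ∈ 𝒜B) (hcov : ReadCovariantOn 𝒜A 𝒜B rA rB κ cr) :
    ∀ (n : ℕ) (gs : ℕ → ℝ), RGEqH n β gs → Step.InInterval γ n gs → ∀ j k : ℕ, j + (k + 1) ≤ n →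
      |β (k + 1) (prefixOf (fun i => gs (j + i)) (k + 1)) - β k (prefixOf (fun i => gs (j + 1 + i)) k)| ≤ cr * C₅ * θ * θ ^ k := by
  intro n gs hR hI j k hjk
  have hw : prefixOf (fun i => gs (j + i)) (k + 1) ∈ Box γ (k + 1) := mem_box.mpr fun i => hI (j + i) (by have := i.isLt; omega)
  have htail : Fin.tail (prefixOf (fun i => gs (j + i)) (k + 1)) = prefixOf (fun i => gs (j + 1 + i)) k := by
    funext i; simp only [Fin.tail, prefixOf_apply, Fin.val_succ]; congr 1; omega
  have h := setShift_of_ne5At h5 hA hB h𝒜A h𝒜B hcov hw (by rw [htail]; exact hWrun n gs hR hI j k hjk)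
  rwa [htail] at h

end Abstract

/-! ## §2 def-W1's kernels (generic term family): the NE5 instance IS the kernel inequality; N18 IN SHIFT FORM ALONG THE RUNS + (D4) ⟹ the run-window N17 text -/

section Kernels

variable {𝔄 : Type*} [NormedRing 𝔄] [NormedAlgebra ℝ 𝔄]
variable {V : Type*} [NormedAddCommGroup V] [NormedSpace ℝ V] {ι : Type*} [Fintype ι]
variable (F : T4Family) (ℰ : TermFamily1 F 𝔄) (ρ : V →L[ℝ] 𝔄) (bV : Module.Basis ι ℝ V)

/-- **THE NE5 INSTANCE AT ONE PAIR `(b, g)` ⟺ THE KERNEL INEQUALITIES AT `g`, ALL LEVELS** (def-W1's `ne5_iff`, pointwise in `g`): on the kernel carrier,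
`∀ U X, |EA g (transport U) X − EB b g U X| ≤ C₅θ^{scale X}e^{−κ d X}` ⟺ `∀ k μ ν z, |Π_{k+1}(g; z) − Π_{k+2}(b, g; z)| ≤ C₅θ^{k+1}e^{−κ|z|₁}`.
[cite: Balaban1987RG1, (1.21) p.264 and Thm 1 p.259 (dictionary)] -/
theorem ne5At_EA_EB_iff_kernel (b : ℝ) (g : ℕ → ℝ) (κ θ C₅ : ℝ) :
    (∀ (U : carriers.BgB) (X : carriers.Dom),
        |EA F ℰ ρ bV g (carriers.transport U) X - EB F ℰ ρ bV b g U X| ≤ C₅ * θ ^ carriers.scale X * Real.exp (-(κ * carriers.d X))) ↔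
      ∀ (k : ℕ) (μ ν : Fin 4) (z : Fin 4 → ℤ),
        |kernelA F ℰ ρ bV g k μ ν z - kernelA F ℰ ρ bV (prependCoupling b g) (k + 1) μ ν z| ≤ C₅ * θ ^ (k + 1) * Real.exp (-(κ * l1 z)) := by
  constructor
  · intro h k μ ν z
    exact h PUnit.unit (pt k μ ν z)
  · rintro h U ⟨k, μ, ν, z⟩
    exact h k μ ν z

/-- Prefix bookkeeping: the kernels at the PADDED window tail `extd (g_{j+1}, …, g_{j+1+k})` are the kernels at the SHIFTED RUN `i ↦ g_{j+1+i}` (level `k + 1` reads `k + 1` entries).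
[cite: Balaban1987RG1, §5 p.298 (prefix dependence; bookkeeping)] -/
theorem kernelA_extd_prefixOf_shift (gs : ℕ → ℝ) (j k : ℕ) :
    kernelA F ℰ ρ bV (extd (prefixOf (fun i => gs (j + 1 + i)) k)) k = kernelA F ℰ ρ bV (fun i => gs (j + 1 + i)) k :=
  kernelA_congr F ℰ ρ bV fun i hi => by rw [extd_prefixOf (Nat.le_of_lt_succ hi)]

/-- Prefix bookkeeping: prepending `g_j` to the padded window tail gives, as far as the level-`(k+2)` kernel reads, the shifted run `i ↦ g_{j+i}`.
[cite: Balaban1987RG1, §5 p.298 and (0.24)–(0.25) p.257 (bookkeeping)] -/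
theorem kernelA_prepend_extd_prefixOf_shift (gs : ℕ → ℝ) (j k : ℕ) :
    kernelA F ℰ ρ bV (prependCoupling (gs j) (extd (prefixOf (fun i => gs (j + 1 + i)) k))) (k + 1) = kernelA F ℰ ρ bV (fun i => gs (j + i)) (k + 1) := by
  refine kernelA_congr F ℰ ρ bV fun i hi => ?_
  cases i with
  | zero => rw [prependCoupling_zero, Nat.add_zero]
  | succ i =>
    rw [prependCoupling_succ, extd_prefixOf (by omega)]
    congr 1
    omega

/-- ★★ **N18 IN SHIFT FORM ALONG THE RUNS + (D4) AT def-W1's FUNCTIONALS ⟹ THE RUN-WINDOW N17 TEXT.**  Hypotheses (all DISPLAYED): the RUN-WINDOW KERNEL STEP RATE — for every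
in-window run of (0.20) of `β` and every window, `|Π_{k+1}(g_{j+1}, g_{j+2}, …; z) − Π_{k+2}(g_j, g_{j+1}, …; z)| ≤ C₅θ^{k+1}e^{−κ|z|₁}` (N18's η-rate asked ONLY where print's two-run
mechanism lives: one more ultraviolet step at the run's OWN couplings) —, the read-outs `rA ∕ rB` representing `β` on the boxes through def-W1's `EA ∕ EB`, slice classes containing
the run-window slices, transport covariance.  Conclusion: dag-n17-w1's run-window text with `a_k = cr·C₅·θ·θ^k`.  This is `SpineRates.n17At_of_u3`'s N17 output in RUN currency from an
N18 input in RUN currency. [cite: Balaban1987RG1, (0.18)–(0.20) pp.255–256, (1.20)–(1.22) p.264, Thm 1 p.259] -/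
theorem runWindowShift_of_runWindowKernelStepRate {𝒜A : Set (Slice carriers carriers.BgA)} {𝒜B : Set (Slice carriers carriers.BgB)}
    {rA : ReadOut carriers carriers.BgA} {rB : ReadOut carriers carriers.BgB} {β : HBeta} {γ κ θ C₅ cr : ℝ}
    (h18run : ∀ (n : ℕ) (gs : ℕ → ℝ), RGEqH n β gs → Step.InInterval γ n gs → ∀ j k : ℕ, j + (k + 1) ≤ n → ∀ (μ ν : Fin 4) (z : Fin 4 → ℤ),
      |kernelA F ℰ ρ bV (fun i => gs (j + 1 + i)) k μ ν z - kernelA F ℰ ρ bV (fun i => gs (j + i)) (k + 1) μ ν z| ≤ C₅ * θ ^ (k + 1) * Real.exp (-(κ * l1 z)))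
    (hA : RepresentsA (EA F ℰ ρ bV) rA γ β) (hB : RepresentsB (EB F ℰ ρ bV) rB γ β)
    (h𝒜A : ∀ (n : ℕ) (gs : ℕ → ℝ), RGEqH n β gs → Step.InInterval γ n gs → ∀ j k : ℕ, j + (k + 1) ≤ n →
      EA F ℰ ρ bV (extd (prefixOf (fun i => gs (j + 1 + i)) k)) ∈ 𝒜A)
    (h𝒜B : ∀ (n : ℕ) (gs : ℕ → ℝ), RGEqH n β gs → Step.InInterval γ n gs → ∀ j k : ℕ, j + (k + 1) ≤ n →
      EB F ℰ ρ bV (gs j) (extd (prefixOf (fun i => gs (j + 1 + i)) k)) ∈ 𝒜B)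
    (hcov : ReadCovariantOn 𝒜A 𝒜B rA rB κ cr) :
    ∀ (n : ℕ) (gs : ℕ → ℝ), RGEqH n β gs → Step.InInterval γ n gs → ∀ j k : ℕ, j + (k + 1) ≤ n →
      |β (k + 1) (prefixOf (fun i => gs (j + i)) (k + 1)) - β k (prefixOf (fun i => gs (j + 1 + i)) k)| ≤ cr * C₅ * θ * θ ^ k := by
  intro n gs hR hI j k hjk
  have hw : prefixOf (fun i => gs (j + i)) (k + 1) ∈ Box γ (k + 1) := mem_box.mpr fun i => hI (j + i) (by have := i.isLt; omega)
  have hw0 : prefixOf (fun i => gs (j + i)) (k + 1) 0 = gs j := by simp [prefixOf_apply]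
  have htail : Fin.tail (prefixOf (fun i => gs (j + i)) (k + 1)) = prefixOf (fun i => gs (j + 1 + i)) k := by
    funext i; simp only [Fin.tail, prefixOf_apply, Fin.val_succ]; congr 1; omega
  have h := shift_le_of_ne5At (C := carriers) hA hB hcov hw
    (by rw [htail]; exact h𝒜A n gs hR hI j k hjk)
    (by rw [htail, hw0]; exact h𝒜B n gs hR hI j k hjk)
    (by
      rw [htail, hw0]
      rintro U ⟨k', μ, ν, z⟩ hX
      have hk' : k' = k := by simpa using hX
      subst hk'
      show |kernelA F ℰ ρ bV _ k' μ ν z - kernelA F ℰ ρ bV (prependCoupling (gs j) _) (k' + 1) μ ν z| ≤ C₅ * θ ^ (k' + 1) * Real.exp (-(κ * l1 z))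
      rw [kernelA_extd_prefixOf_shift, kernelA_prepend_extd_prefixOf_shift]
      exact h18run n gs hR hI j k' hjk μ ν z)
  rwa [htail] at h

/-- **BOX ⟹ RUN FORM**: W1-21's box-keyed `KernelStepRate … γ κ θ C₅` implies the run-window kernel step rate on every in-window sequence (run or not — `RGEqH` is not even used):
evaluate the letter at `b := g_j`, `g := extd (g_{j+1}, …, g_{j+1+k})` ∈ `]0,γ]^ℕ` and read prefixes. [cite: Balaban1987RG1, Thm 1 p.259 and (1.21) p.264] -/
theorem runWindowKernelStepRate_of_kernelStepRate {β : HBeta} {γ κ θ C₅ : ℝ} (h18 : KernelStepRate F ℰ ρ bV γ κ θ C₅) :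
    ∀ (n : ℕ) (gs : ℕ → ℝ), RGEqH n β gs → Step.InInterval γ n gs → ∀ j k : ℕ, j + (k + 1) ≤ n → ∀ (μ ν : Fin 4) (z : Fin 4 → ℤ),
      |kernelA F ℰ ρ bV (fun i => gs (j + 1 + i)) k μ ν z - kernelA F ℰ ρ bV (fun i => gs (j + i)) (k + 1) μ ν z| ≤ C₅ * θ ^ (k + 1) * Real.exp (-(κ * l1 z)) := by
  intro n gs _ hI j k hjk μ ν z
  have hb : 0 < gs j ∧ gs j ≤ γ := hI j (by omega)
  have hg : extd (prefixOf (fun i => gs (j + 1 + i)) k) ∈ Window γ :=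
    extd_mem_window (mem_box.mpr fun i => hI (j + 1 + i) (by have := i.isLt; omega))
  have h := h18 (gs j) hb.1 hb.2 _ hg k μ ν z
  rwa [kernelA_extd_prefixOf_shift, kernelA_prepend_extd_prefixOf_shift] at h

end Kernels

/-! ## §3 K3 currency (`YMDAG.UVSplit`): the (D4) binder `ReadOutAt D u` + NE5 on the run windows of `D.βfun` ⟹ the run-window N17 text for `D.βfun` -/

section Carriers

variable {F : T4Family} {N : ℕ} [NeZero N]

/-- ★★ **(D4) + THE RUN-MATCHED NE5 INSTANCES ⟹ RUN-WINDOW N17 ON THE DATUM (the F-E-robust keying at K3's carriers).**  `ReadOutAt D u` (the β-read-out binders of K3's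
`PHolderD4`, `SpineRates` :151) supplies the read-outs, the slice classes on `u.W ⊇` padded boxes and the covariance with `u.cr`; add, for every in-window (0.20)-run of `D.βfun` and
every window, the NE5 INSTANCE of `u.EA ∕ u.EB (g_j)` at the MATCHED re-indexed sequence `extd (g_{j+1}, …, g_{j+k+1})` on the scale-`(k+1)` points (run B's first coupling = the
run's own `g_j`; NO free `b`, NO box) ⟹ dag-n17-w1's run-window text for `D.βfun` with `a_k = u.cr·u.C₅·u.θ·u.θ^k`.  The box-wide conjunct `N18At u` is NOT used; the slice
memberships come free from `ReadOutAt`'s classes because windows of in-window runs are box histories. [cite: Balaban1987RG1, (0.18)–(0.20) pp.255–256, (1.20)–(1.22) p.264, Thm 1 p.259] -/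
theorem runWindowShift_of_readOutAt_ne5AtRunWindows (D : Datum F N) {u : U3Carriers} (hD4 : ReadOutAt D u)
    (h5run : ∀ (n : ℕ) (gs : ℕ → ℝ), RGEqH n D.βfun gs → Step.InInterval u.γ n gs → ∀ j k : ℕ, j + (k + 1) ≤ n →
      ∀ (U : u.C.BgB) (X : u.C.Dom), u.C.scale X = k + 1 →
        |u.EA (extd (prefixOf (fun i => gs (j + 1 + i)) k)) (u.C.transport U) X - u.EB (gs j) (extd (prefixOf (fun i => gs (j + 1 + i)) k)) U X| ≤
          u.C₅ * u.θ ^ (k + 1) * Real.exp (-(u.κ * u.C.d X))) :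
    ∀ (n : ℕ) (gs : ℕ → ℝ), RGEqH n D.βfun gs → Step.InInterval u.γ n gs → ∀ j k : ℕ, j + (k + 1) ≤ n →
      |D.βfun (k + 1) (prefixOf (fun i => gs (j + i)) (k + 1)) - D.βfun k (prefixOf (fun i => gs (j + 1 + i)) k)| ≤ u.cr * u.C₅ * u.θ * u.θ ^ k := by
  obtain ⟨𝒜A, 𝒜B, rA, rB, hW, hA, hB, h𝒜A, h𝒜B, -, hcov, -⟩ := hD4
  refine runWindowShift_of_ne5AtRunWindows hA hB hcov (fun n gs _ hI j k hjk => h𝒜A _ ?_) (fun n gs _ hI j k hjk => h𝒜B (gs j) (hI j (by omega)).1 (hI j (by omega)).2 _ ?_) h5run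
  · exact hW k _ (mem_box.mpr fun i => hI (j + 1 + i) (by have := i.isLt; omega))
  · exact hW k _ (mem_box.mpr fun i => hI (j + 1 + i) (by have := i.isLt; omega))

/-- **THE BOX-KEYED N18 CONJUNCT IS MORE THAN ENOUGH**: `ReadOutAt D u ∧ N18At u` ⟹ the run-window N17 text (because windows of in-window runs are box histories and `u.W ⊇` padded
boxes) — `SpineRates.n17At_of_u3`'s N17 FACTORS through the run-window text; only this factor is what the K2 road reads (dag-n17-w1 F5 (β)∕(γ)).
[cite: Balaban1987RG1, (0.18)–(0.20) pp.255–256, (1.20)–(1.22) p.264, Thm 1 p.259] -/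
theorem runWindowShift_of_readOutAt_n18At (D : Datum F N) {u : U3Carriers} (hD4 : ReadOutAt D u) (h18 : N18At u) :
    ∀ (n : ℕ) (gs : ℕ → ℝ), RGEqH n D.βfun gs → Step.InInterval u.γ n gs → ∀ j k : ℕ, j + (k + 1) ≤ n →
      |D.βfun (k + 1) (prefixOf (fun i => gs (j + i)) (k + 1)) - D.βfun k (prefixOf (fun i => gs (j + 1 + i)) k)| ≤ u.cr * u.C₅ * u.θ * u.θ ^ k := by
  obtain ⟨𝒜A, 𝒜B, rA, rB, hW, hA, hB, h𝒜A, h𝒜B, -, hcov, -⟩ := hD4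
  intro n gs _ hI j k hjk
  have hw : prefixOf (fun i => gs (j + i)) (k + 1) ∈ Box u.γ (k + 1) := mem_box.mpr fun i => hI (j + i) (by have := i.isLt; omega)
  have htail : Fin.tail (prefixOf (fun i => gs (j + i)) (k + 1)) = prefixOf (fun i => gs (j + 1 + i)) k := by
    funext i; simp only [Fin.tail, prefixOf_apply, Fin.val_succ]; congr 1; omega
  have h := setShift_of_ne5At h18 hA hB h𝒜A h𝒜B hcov hw (hW k _ (tail_mem_box hw))
  rwa [htail] at h

end Carriers

end YMDAG.N18.RunWindowEdge
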